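import Mathlib

/-!
# Dominant term of a bounded double `p`-adic power series along `z ↦ ((1+z)^b - 1, (1+z)^a - 1)`

Stub `stub_twoVarDominant` of the line `lambda-layer-one` of the crux `EdgeDecay`
(`Summit.BirchSwinnertonDyer.BirchSwinnertonDyer.Theses.TangentCone.EdgeDecay`).

Elementary ultrametric analysis. Let `F : ℕ → ℕ → ℚ_[p]` be bounded by `M`, vanishing in total
degree `< d`, and suppose its degree-`d` form `F_d(X, Y) = ∑_{i+j=d} F i j X^i Y^j` does not vanish at
`(X, Y) = (b, a)`. Along the curve `z ↦ (x, y) = ((1+z)^b - 1, (1+z)^a - 1)` one has `x = u z`,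
`y = v z` with `‖u‖, ‖v‖ ≤ 1`, `‖u - b‖, ‖v - a‖ ≤ ‖z‖`; hence
`∑ F i j x^i y^j = F_d(b, a) z^d + E` with `‖E‖ ≤ M ‖z‖^(d+1)`, and the ultrametric equality
`‖A + E‖ = ‖A‖` (`‖E‖ < ‖A‖`) gives `‖∑ F i j x^i y^j‖ = ‖F_d(b,a)‖ ‖z‖^d` once `M ‖z‖ < ‖F_d(b,a)‖`.
-/

set_option linter.dupNamespace false

namespace Summit.BirchSwinnertonDyer.BirchSwinnertonDyer.Theorems

open Filter Topology

section TwoVarDominantHelpers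

variable {p : ℕ} [Fact p.Prime]

/-- `‖1 + z‖ ≤ 1` for `z` in the closed unit ball of `ℚ_[p]`. [folklore] -/
private theorem twoVarDominant_norm_one_add_le {z : ℚ_[p]} (hz : ‖z‖ ≤ 1) : ‖1 + z‖ ≤ 1 := by
  refine (Padic.nonarchimedean 1 z).trans (max_le ?_ hz)
  rw [norm_one]

/-- Geometric sums of an element of the closed unit ball lie in the closed unit ball. [folklore] -/
private theorem twoVarDominant_norm_geom_sum_le {w : ℚ_[p]} (hw : ‖w‖ ≤ 1) (n : ℕ) :
    ‖∑ i ∈ Finset.range n, w ^ i‖ ≤ 1 := by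
  refine IsUltrametricDist.norm_sum_le_of_forall_le_of_nonneg zero_le_one fun i _ => ?_
  rw [norm_pow]
  exact pow_le_one₀ (norm_nonneg _) hw

/-- `(1+z)^n - 1 = (∑_{i<n} (1+z)^i) · z`. [folklore] -/
private theorem twoVarDominant_pow_sub_one_eq (z : ℚ_[p]) (n : ℕ) :
    (1 + z) ^ n - 1 = (∑ i ∈ Finset.range n, (1 + z) ^ i) * z := by
  have h := geom_sum_mul (1 + z) n
  rw [add_sub_cancel_left] at h
  exact h.symm

/-- `‖(1+z)^n - 1‖ ≤ ‖z‖` for `‖z‖ ≤ 1`. [folklore] -/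
private theorem twoVarDominant_norm_pow_sub_one_le {z : ℚ_[p]} (hz : ‖z‖ ≤ 1) (n : ℕ) :
    ‖(1 + z) ^ n - 1‖ ≤ ‖z‖ := by
  rw [twoVarDominant_pow_sub_one_eq, norm_mul]
  exact mul_le_of_le_one_left (norm_nonneg _)
    (twoVarDominant_norm_geom_sum_le (twoVarDominant_norm_one_add_le hz) n)

/-- `‖∑_{i<n} (1+z)^i - n‖ ≤ ‖z‖` for `‖z‖ ≤ 1`. [folklore] -/
private theorem twoVarDominant_norm_geom_sum_sub_le {z : ℚ_[p]} (hz : ‖z‖ ≤ 1) (n : ℕ) :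
    ‖∑ i ∈ Finset.range n, (1 + z) ^ i - (n : ℚ_[p])‖ ≤ ‖z‖ := by
  have h : ∑ i ∈ Finset.range n, (1 + z) ^ i - (n : ℚ_[p]) =
      ∑ i ∈ Finset.range n, ((1 + z) ^ i - 1) := by
    rw [Finset.sum_sub_distrib, Finset.sum_const, Finset.card_range, nsmul_eq_mul, mul_one]
  rw [h]
  exact IsUltrametricDist.norm_sum_le_of_forall_le_of_nonneg (norm_nonneg _)
    fun i _ => twoVarDominant_norm_pow_sub_one_le hz i

/-- The curve factorisation: `(1+z)^n - 1 = u z` with `‖u‖ ≤ 1` and `‖u - n‖ ≤ ‖z‖`. [folklore] -/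
private theorem twoVarDominant_curve_factor {z : ℚ_[p]} (hz : ‖z‖ ≤ 1) (n : ℕ) :
    ∃ u : ℚ_[p], ‖u‖ ≤ 1 ∧ ‖u - n‖ ≤ ‖z‖ ∧ (1 + z) ^ n - 1 = u * z :=
  ⟨∑ i ∈ Finset.range n, (1 + z) ^ i,
    twoVarDominant_norm_geom_sum_le (twoVarDominant_norm_one_add_le hz) n,
    twoVarDominant_norm_geom_sum_sub_le hz n, twoVarDominant_pow_sub_one_eq z n⟩

/-- In the closed unit ball, `‖u v - u' v'‖ ≤ r` as soon as `‖u - u'‖, ‖v - v'‖ ≤ r`. [folklore] -/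
private theorem twoVarDominant_norm_mul_sub_mul_le {u v u' v' : ℚ_[p]} {r : ℝ} (hu : ‖u‖ ≤ 1)
    (hv' : ‖v'‖ ≤ 1) (h1 : ‖u - u'‖ ≤ r) (h2 : ‖v - v'‖ ≤ r) : ‖u * v - u' * v'‖ ≤ r := by
  have hr : 0 ≤ r := (norm_nonneg _).trans h1
  have heq : u * v - u' * v' = u * (v - v') + (u - u') * v' := by ring
  rw [heq]
  refine (Padic.nonarchimedean _ _).trans (max_le ?_ ?_)
  · rw [norm_mul]
    calc ‖u‖ * ‖v - v'‖ ≤ 1 * r := mul_le_mul hu h2 (norm_nonneg _) zero_le_one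
      _ = r := one_mul r
  · rw [norm_mul]
    calc ‖u - u'‖ * ‖v'‖ ≤ r * 1 := mul_le_mul h1 hv' (norm_nonneg _) hr
      _ = r := mul_one r

/-- In the closed unit ball, `‖u^m - w^m‖ ≤ ‖u - w‖`. [folklore] -/
private theorem twoVarDominant_norm_pow_sub_pow_le {u w : ℚ_[p]} (hu : ‖u‖ ≤ 1) (hw : ‖w‖ ≤ 1)
    (m : ℕ) : ‖u ^ m - w ^ m‖ ≤ ‖u - w‖ := by
  induction m with
  | zero => simp
  | succ m ih =>
    rw [pow_succ, pow_succ]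
    exact twoVarDominant_norm_mul_sub_mul_le
      (by rw [norm_pow]; exact pow_le_one₀ (norm_nonneg _) hu) hw ih le_rfl

/-- The norm of a natural number in `ℚ_[p]` is at most `1`. [folklore] -/
private theorem twoVarDominant_norm_natCast_le_one (n : ℕ) : ‖(n : ℚ_[p])‖ ≤ 1 := by
  have h := Padic.norm_int_le_one (p := p) (n : ℤ)
  rwa [Int.cast_natCast] at h

end TwoVarDominantHelpers

/-- A sum over the antidiagonal `{(i, j) : i + j = d}` written as a `Finset.range (d+1)` sum over
`j`, with `i = d - j`. [folklore] -/
private theorem twoVarDominant_sum_antidiagonal_eq {N : Type*} [AddCommMonoid N] (d : ℕ)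
    (G : ℕ × ℕ → N) :
    ∑ n ∈ Finset.HasAntidiagonal.antidiagonal d, G n = ∑ j ∈ Finset.range (d + 1), G (d - j, j) := by
  rw [← Finset.Nat.sum_antidiagonal_swap, Finset.Nat.sum_antidiagonal_eq_sum_range_succ_mk]
  rfl

/-- **Dominant term along the curve `z ↦ ((1+z)^b-1, (1+z)^a-1)`** (elementary ultrametric
analysis): if the bounded double series `F` vanishes in total degree `< d` and its degree-`d` form is
non-zero at `(b, a)`, then `‖F((1+z)^b-1, (1+z)^a-1)‖ = ‖F_d(b,a)‖ ‖z‖^d` for `‖z‖` small. [folklore] -/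
theorem stub_twoVarDominant :
    ∀ (p : ℕ) [Fact p.Prime] (F : ℕ → ℕ → ℚ_[p]) (M : ℝ) (d a b : ℕ), (∀ i j : ℕ, ‖F i j‖ ≤ M) → (∀ i j : ℕ, i + j < d → F i j = 0) → ∑ j ∈ Finset.range (d + 1), F (d - j) j * (b : ℚ_[p]) ^ (d - j) * (a : ℚ_[p]) ^ j ≠ 0 → ∃ m₀ : ℕ, ∀ z : ℚ_[p], z ≠ 0 → ‖z‖ ≤ (p : ℝ) ^ (-(m₀ : ℤ) - 1) → ‖∑' n : ℕ × ℕ, F n.1 n.2 * ((1 + z) ^ b - 1) ^ n.1 * ((1 + z) ^ a - 1) ^ n.2‖ = ‖∑ j ∈ Finset.range (d + 1), F (d - j) j * (b : ℚ_[p]) ^ (d - j) * (a : ℚ_[p]) ^ j‖ * ‖z‖ ^ d := by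
  intro p _ F M d a b hFM hlow hFd
  have hp : Nat.Prime p := Fact.out
  have hp1 : (1 : ℝ) < p := by exact_mod_cast hp.one_lt
  have hM0 : 0 ≤ M := (norm_nonneg _).trans (hFM 0 0)
  set c : ℚ_[p] := ∑ j ∈ Finset.range (d + 1), F (d - j) j * (b : ℚ_[p]) ^ (d - j) * (a : ℚ_[p]) ^ j
    with hc
  have hcpos : 0 < ‖c‖ := norm_pos_iff.mpr hFd
  -- choose `m₀` with `M p^{-m₀} < ‖c‖`
  obtain ⟨m₀, hm₀⟩ : ∃ m₀ : ℕ, M * (p : ℝ)⁻¹ ^ m₀ < ‖c‖ := by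
    have ht : Tendsto (fun m : ℕ => M * (p : ℝ)⁻¹ ^ m) atTop (𝓝 (M * 0)) :=
      (tendsto_pow_atTop_nhds_zero_of_lt_one (by positivity) (inv_lt_one_of_one_lt₀ hp1)).const_mul _
    rw [mul_zero] at ht
    exact (ht.eventually (gt_mem_nhds hcpos)).exists
  refine ⟨m₀, fun z hz0 hzle => ?_⟩
  -- basic bounds on `‖z‖`
  have hz1 : ‖z‖ < 1 := lt_of_le_of_lt hzle (zpow_lt_one_of_neg₀ hp1 (by omega))
  have hz1' : ‖z‖ ≤ 1 := hz1.le
  have hz0' : 0 < ‖z‖ := norm_pos_iff.mpr hz0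
  have hMz : M * ‖z‖ < ‖c‖ := by
    refine lt_of_le_of_lt (mul_le_mul_of_nonneg_left (hzle.trans ?_) hM0) hm₀
    rw [inv_pow, ← zpow_natCast, ← zpow_neg]
    exact zpow_le_zpow_right₀ hp1.le (by omega)
  -- the curve factorisation `x = u z`, `y = v z`
  obtain ⟨u, hu1, hub, hxu⟩ := twoVarDominant_curve_factor hz1' b
  obtain ⟨v, hv1, hva, hyv⟩ := twoVarDominant_curve_factor hz1' a
  rw [hxu, hyv]
  have ha1 : ‖(a : ℚ_[p])‖ ≤ 1 := twoVarDominant_norm_natCast_le_one a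
  have hb1 : ‖(b : ℚ_[p])‖ ≤ 1 := twoVarDominant_norm_natCast_le_one b
  have huz : ‖u * z‖ ≤ ‖z‖ := by
    rw [norm_mul]; exact mul_le_of_le_one_left (norm_nonneg _) hu1
  have hvz : ‖v * z‖ ≤ ‖z‖ := by
    rw [norm_mul]; exact mul_le_of_le_one_left (norm_nonneg _) hv1
  -- the general term and its bound
  set f : ℕ × ℕ → ℚ_[p] := fun n => F n.1 n.2 * (u * z) ^ n.1 * (v * z) ^ n.2 with hf
  have hterm : ∀ n : ℕ × ℕ, ‖f n‖ ≤ M * (‖z‖ ^ n.1 * ‖z‖ ^ n.2) := by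
    intro n
    show ‖F n.1 n.2 * (u * z) ^ n.1 * (v * z) ^ n.2‖ ≤ _
    rw [norm_mul, norm_mul, norm_pow, norm_pow, mul_assoc]
    exact mul_le_mul (hFM _ _)
      (mul_le_mul (pow_le_pow_left₀ (norm_nonneg _) huz _) (pow_le_pow_left₀ (norm_nonneg _) hvz _)
        (by positivity) (by positivity)) (by positivity) hM0
  -- summability (domination by `M` times a product of two geometric series)
  have hgeo : Summable (fun n : ℕ => ‖z‖ ^ n) := summable_geometric_of_lt_one (norm_nonneg _) hz1
  have hsum : Summable f :=
    Summable.of_norm_bounded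
      ((hgeo.mul_of_nonneg hgeo (fun _ => pow_nonneg (norm_nonneg _) _)
        (fun _ => pow_nonneg (norm_nonneg _) _)).mul_left M) hterm
  -- split off the antidiagonal `i + j = d`
  have hsplit := (hsum.sum_add_tsum_subtype_compl (Finset.HasAntidiagonal.antidiagonal d)).symm
  -- the tail
  have htail : ‖∑' n : {n // n ∉ Finset.HasAntidiagonal.antidiagonal d}, f n‖ ≤ M * ‖z‖ ^ (d + 1) := by
    refine IsUltrametricDist.norm_tsum_le_of_forall_le_of_nonneg (by positivity) ?_
    rintro ⟨n, hn⟩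
    rw [Finset.HasAntidiagonal.mem_antidiagonal] at hn
    show ‖f n‖ ≤ _
    rcases lt_or_gt_of_ne hn with hlt | hgt
    · show ‖F n.1 n.2 * (u * z) ^ n.1 * (v * z) ^ n.2‖ ≤ _
      rw [hlow n.1 n.2 hlt, zero_mul, zero_mul, norm_zero]
      positivity
    · calc ‖f n‖ ≤ M * (‖z‖ ^ n.1 * ‖z‖ ^ n.2) := hterm n
        _ = M * ‖z‖ ^ (n.1 + n.2) := by rw [pow_add]
        _ ≤ M * ‖z‖ ^ (d + 1) :=
          mul_le_mul_of_nonneg_left (pow_le_pow_of_le_one (norm_nonneg _) hz1' hgt) hM0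
  -- the finite part
  have hfin : ∑ n ∈ Finset.HasAntidiagonal.antidiagonal d, f n =
      z ^ d * ∑ n ∈ Finset.HasAntidiagonal.antidiagonal d, F n.1 n.2 * u ^ n.1 * v ^ n.2 := by
    rw [Finset.mul_sum]
    refine Finset.sum_congr rfl fun n hn => ?_
    rw [Finset.HasAntidiagonal.mem_antidiagonal] at hn
    show F n.1 n.2 * (u * z) ^ n.1 * (v * z) ^ n.2 = _
    rw [← hn, mul_pow, mul_pow, pow_add]
    ring
  have hcc : ∑ n ∈ Finset.HasAntidiagonal.antidiagonal d, F n.1 n.2 * (b : ℚ_[p]) ^ n.1 * (a : ℚ_[p]) ^ n.2 = c := by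
    rw [hc]
    exact twoVarDominant_sum_antidiagonal_eq d
      (fun n => F n.1 n.2 * (b : ℚ_[p]) ^ n.1 * (a : ℚ_[p]) ^ n.2)
  have hdiff : ‖(∑ n ∈ Finset.HasAntidiagonal.antidiagonal d, F n.1 n.2 * u ^ n.1 * v ^ n.2) - c‖ ≤ M * ‖z‖ := by
    rw [← hcc, ← Finset.sum_sub_distrib]
    refine IsUltrametricDist.norm_sum_le_of_forall_le_of_nonneg (by positivity) fun n _ => ?_
    have heq : F n.1 n.2 * u ^ n.1 * v ^ n.2 - F n.1 n.2 * (b : ℚ_[p]) ^ n.1 * (a : ℚ_[p]) ^ n.2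
        = F n.1 n.2 * (u ^ n.1 * v ^ n.2 - (b : ℚ_[p]) ^ n.1 * (a : ℚ_[p]) ^ n.2) := by ring
    rw [heq, norm_mul]
    refine mul_le_mul (hFM _ _) ?_ (norm_nonneg _) hM0
    exact twoVarDominant_norm_mul_sub_mul_le
      (by rw [norm_pow]; exact pow_le_one₀ (norm_nonneg _) hu1)
      (by rw [norm_pow]; exact pow_le_one₀ (norm_nonneg _) ha1)
      ((twoVarDominant_norm_pow_sub_pow_le hu1 hb1 n.1).trans hub)
      ((twoVarDominant_norm_pow_sub_pow_le hv1 ha1 n.2).trans hva)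
  -- assemble: `∑' f = c z^d + E` with `‖E‖ < ‖c z^d‖`
  set A : ℚ_[p] := ∑ n ∈ Finset.HasAntidiagonal.antidiagonal d, F n.1 n.2 * u ^ n.1 * v ^ n.2 with hA
  set T : ℚ_[p] := ∑' n : {n // n ∉ Finset.HasAntidiagonal.antidiagonal d}, f n with hT
  have hkey : ∑' n, f n = c * z ^ d + ((A - c) * z ^ d + T) := by
    rw [hsplit, hfin]
    ring
  have hzd : 0 < ‖z‖ ^ d := pow_pos hz0' d
  have hE : ‖(A - c) * z ^ d + T‖ < ‖c * z ^ d‖ := by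
    refine lt_of_le_of_lt (Padic.nonarchimedean _ _) (max_lt ?_ ?_)
    · rw [norm_mul, norm_mul, norm_pow]
      exact mul_lt_mul_of_pos_right (lt_of_le_of_lt hdiff hMz) hzd
    · rw [norm_mul, norm_pow]
      calc ‖T‖ ≤ M * ‖z‖ ^ (d + 1) := htail
        _ = M * ‖z‖ * ‖z‖ ^ d := by ring
        _ < ‖c‖ * ‖z‖ ^ d := mul_lt_mul_of_pos_right hMz hzd
  rw [hkey, Padic.add_eq_max_of_ne (ne_of_gt hE), max_eq_left hE.le, norm_mul, norm_pow]

end Summit.BirchSwinnertonDyer.BirchSwinnertonDyer.Theorems
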